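import Literature.Analysis.DeBrangesSpaces.Basic
import Literature.Analysis.DeBrangesSpaces.HalfPlaneCauchy
import HarnessLib

/-!
# The reproducing kernel of a de Branges space (Conrey–Li 2000, §2, (2.2))

For a Hermite–Biehler function `E` without real zeros we prove the reproducing-kernel identity
of `𝓗(E)` in the form used by Conrey–Li:

* `deBrangesInner_deBrangesKernel`: `⟨F, K(w, ·)⟩_{𝓗(E)} = F(w)` for every non-real `w` and
  every entire `F` with `F/E ∈ L²(ℝ)` and `F/E, F♯/E = O(1/√(Im z))` far out in the upper
  half-plane (Conrey–Li (2.2); de Branges 1968, Thm 20) — by Cauchy's theorem and formula for the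
  upper half-plane along `ℝ` (`HalfPlaneCauchy.lean`) applied to `F/E` and `F♯/E`;
* `exists_differentiable_eq_deBrangesKernel`: `z ↦ K(w, z)` extends to an entire function (the
  tree's `deBrangesKernel E w` has the junk value `0` at the removable singularity `z = w̄`),
  with the value `(conj E′(w) E(w̄) − E′(w̄) conj E(w))/(2πi)` there;
* the kernel functions belong to the class above (`integrable_sq_norm_deBrangesKernel_div`,
  `exists_bound_deBrangesKernel_div`), hence `‖K(w, ·)‖² = K(w, w)`
  (`deBrangesNormSq_deBrangesKernel`) and, by Cauchy–Schwarz, every `F` of the class satisfies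
  Conrey–Li's inequality (2.1), `|F(z)|² ≤ ‖F‖² K(z, z)` (`hasKernelBound_of_bound`).

## References

* J. B. Conrey, X.-J. Li, IMRN 2000:18 = arXiv:math/9812166, §2, (2.1)–(2.2) [ConreyLi2000].
* L. de Branges, *Hilbert spaces of entire functions* (1968), Thms 19–20.
-/

noncomputable section

open scoped Real Topology ComplexConjugate
open _root_.Complex _root_.MeasureTheory _root_.Filter _root_.Set

namespace Literature.Analysis.DeBrangesSpaces

variable {E : ℂ → ℂ}

/-! ### Hermite–Biehler functions without real zeros -/

/-- A Hermite–Biehler function without real zeros has no zeros in the closed upper half-plane.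
[folklore] -/
theorem IsHermiteBiehler.ne_zero_of_im_nonneg (hE : IsHermiteBiehler E) (hreal : ∀ x : ℝ, E x ≠ 0)
    {z : ℂ} (hz : 0 ≤ z.im) : E z ≠ 0 := by
  rcases hz.lt_or_eq with h | h
  · exact hE.ne_zero_of_im_pos h
  · have : z = (z.re : ℂ) := Complex.ext (by simp) (by simp [← h])
    rw [this]
    exact hreal z.re

/-- … and `E♯` has no zeros in the closed lower half-plane. [folklore] -/
theorem IsHermiteBiehler.sharp_ne_zero_of_im_nonpos (hE : IsHermiteBiehler E)
    (hreal : ∀ x : ℝ, E x ≠ 0) {z : ℂ} (hz : z.im ≤ 0) : sharp E z ≠ 0 := by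
  rw [sharp_apply, map_ne_zero]
  exact hE.ne_zero_of_im_nonneg hreal (by simpa using hz)

/-- `‖E♯(z)‖ ≤ ‖E(z)‖` on the closed upper half-plane. [folklore] -/
theorem IsHermiteBiehler.norm_sharp_le (hE : IsHermiteBiehler E) {z : ℂ} (hz : 0 ≤ z.im) :
    ‖sharp E z‖ ≤ ‖E z‖ := by
  rcases hz.lt_or_eq with h | h
  · exact (hE.norm_sharp_lt h).le
  · rw [norm_sharp, Complex.conj_eq_iff_im.2 h.symm]

/-- `√(Im z) ≤ ‖z‖` once `‖z‖ ≥ 1`. [folklore] -/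
theorem sqrt_im_le_norm {z : ℂ} (h1 : 1 ≤ ‖z‖) : √z.im ≤ ‖z‖ := by
  have him : z.im ≤ ‖z‖ := (le_abs_self _).trans (Complex.abs_im_le_norm z)
  calc √z.im ≤ √‖z‖ := Real.sqrt_le_sqrt him
    _ ≤ ‖z‖ := by
        rw [Real.sqrt_le_left (by linarith)]
        nlinarith

/-! ### Algebra of the kernel -/

/-- The numerator of `K(w, z)` vanishes at `z = w̄` (so the singularity there is removable).
[folklore] -/
theorem kernel_numerator_conj (E : ℂ → ℂ) (w : ℂ) :
    E (conj w) * conj (E w) - sharp E (conj w) * conj (sharp E w) = 0 := by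
  simp only [sharp_apply, Complex.conj_conj]
  ring

/-- `K(w, ·)♯ = K(w̄, ·)`, an identity valid for every `E` (including at the junk values).
[folklore] -/
theorem sharp_deBrangesKernel (E : ℂ → ℂ) (w z : ℂ) :
    sharp (deBrangesKernel E w) z = deBrangesKernel E (conj w) z := by
  simp only [sharp_apply, deBrangesKernel, map_div₀, map_mul, map_sub, Complex.conj_conj,
    Complex.conj_I, Complex.conj_ofReal, map_ofNat]
  rw [← neg_div_neg_eq]
  ring

/-- Norm bound for the kernel: `‖K(w, z)‖ ≤ (‖E z‖‖E w‖ + ‖E♯ z‖‖E♯ w‖)/(2π ‖w̄ − z‖)`.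
[folklore] -/
theorem norm_deBrangesKernel_le (E : ℂ → ℂ) (w z : ℂ) :
    ‖deBrangesKernel E w z‖ ≤
      (‖E z‖ * ‖E w‖ + ‖sharp E z‖ * ‖sharp E w‖) / (2 * π * ‖conj w - z‖) := by
  unfold deBrangesKernel
  rw [norm_div]
  have hden : ‖2 * (π : ℂ) * I * (conj w - z)‖ = 2 * π * ‖conj w - z‖ := by
    rw [norm_mul, norm_mul, norm_mul, Complex.norm_I, mul_one, Complex.norm_real,
      Real.norm_of_nonneg Real.pi_pos.le, Complex.norm_ofNat]
  rw [hden]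
  refine div_le_div_of_nonneg_right ?_ (by positivity)
  refine (norm_sub_le _ _).trans ?_
  rw [norm_mul, norm_mul, Complex.norm_conj, Complex.norm_conj]

/-- Norm bound for `K(w, z)/E(z)` on the closed upper half-plane:
`‖K(w, z)/E(z)‖ ≤ (‖E w‖ + ‖E♯ w‖)/(2π) / ‖z − w̄‖`. [folklore] -/
theorem norm_deBrangesKernel_div_le (hE : IsHermiteBiehler E) (hreal : ∀ x : ℝ, E x ≠ 0)
    (w : ℂ) {z : ℂ} (hz : 0 ≤ z.im) :
    ‖deBrangesKernel E w z / E z‖ ≤ (‖E w‖ + ‖sharp E w‖) / (2 * π) / ‖z - conj w‖ := by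
  by_cases hzw : z = conj w
  · subst hzw
    simp [deBrangesKernel]
  have hEz : 0 < ‖E z‖ := norm_pos_iff.2 (hE.ne_zero_of_im_nonneg hreal hz)
  have hzw' : 0 < ‖z - conj w‖ := norm_pos_iff.2 (sub_ne_zero.2 hzw)
  have hzw'' : ‖conj w - z‖ = ‖z - conj w‖ := norm_sub_rev _ _
  rw [norm_div, div_le_iff₀ hEz]
  refine (norm_deBrangesKernel_le E w z).trans ?_
  rw [hzw'', div_le_iff₀ (by positivity)]
  have hs : ‖sharp E z‖ ≤ ‖E z‖ := hE.norm_sharp_le hz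
  have : (‖E w‖ + ‖sharp E w‖) / (2 * π) / ‖z - conj w‖ * ‖E z‖ * (2 * π * ‖z - conj w‖) =
      ‖E z‖ * ‖E w‖ + ‖E z‖ * ‖sharp E w‖ := by
    field_simp
  rw [this]
  nlinarith [norm_nonneg (sharp E w)]

/-! ### The kernel functions: entire extension, square integrability, decay -/

/-- **`K(w, ·)` is entire.** There is an entire function agreeing with `z ↦ K(w, z)` off the
removable singularity `z = w̄`, whose value at `w̄` is `(conj E′(w) E(w̄) − E′(w̄) conj E(w))/(2πi)`
(for a zero `w` of `E` with `w̄ = w + i` this is Conrey–Li's `K(w, w + i) = conj E′(w) E(w+i)/2πi`).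
[folklore] -/
theorem exists_differentiable_eq_deBrangesKernel (hE : Differentiable ℂ E) (w : ℂ) :
    ∃ K : ℂ → ℂ, Differentiable ℂ K ∧ (∀ z : ℂ, z ≠ conj w → K z = deBrangesKernel E w z) ∧
      K (conj w) = (conj (deriv E w) * E (conj w) - deriv E (conj w) * conj (E w)) /
        (2 * π * I) := by
  set N : ℂ → ℂ := fun z ↦ E z * conj (E w) - sharp E z * conj (sharp E w) with hN
  have hNd : Differentiable ℂ N := (hE.mul_const _).sub ((differentiable_sharp hE).mul_const _)
  have hN0 : N (conj w) = 0 := kernel_numerator_conj E w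
  have hπ : (2 * π * I : ℂ) ≠ 0 := by simp [Real.pi_ne_zero]
  refine ⟨fun z ↦ -(2 * π * I)⁻¹ * dslope N (conj w) z, ?_, ?_, ?_⟩
  · refine (differentiable_const _).mul fun z ↦ ?_
    by_cases hz : z = conj w
    · subst hz
      obtain ⟨p, hp⟩ := hNd.analyticAt (conj w)
      exact hp.has_fpower_series_dslope_fslope.analyticAt.differentiableAt
    · exact (differentiableAt_dslope_of_ne hz).2 (hNd z)
  · intro z hz
    simp only
    rw [dslope_of_ne _ hz, slope_def_field, hN0, sub_zero]
    simp only [deBrangesKernel, hN]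
    have h2 : z - conj w ≠ 0 := sub_ne_zero.2 hz
    have h3 : conj w - z ≠ 0 := sub_ne_zero.2 (Ne.symm hz)
    field_simp
    ring
  · simp only
    rw [dslope_same]
    have hsharp : HasDerivAt (sharp E) (conj (deriv E w)) (conj w) :=
      (hE w).hasDerivAt.conj_conj
    have hderiv : deriv N (conj w) =
        deriv E (conj w) * conj (E w) - conj (deriv E w) * conj (sharp E w) :=
      (((hE (conj w)).hasDerivAt.mul_const _).sub (hsharp.mul_const _)).deriv
    rw [hderiv]
    simp only [sharp_apply, Complex.conj_conj]
    field_simp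
    ring

/-- `x ↦ K(w, x)` is continuous on `ℝ` for non-real `w`. [folklore] -/
theorem continuous_deBrangesKernel_ofReal (hE : Differentiable ℂ E) {w : ℂ} (hw : w.im ≠ 0) :
    Continuous fun x : ℝ ↦ deBrangesKernel E w x := by
  unfold deBrangesKernel
  refine Continuous.div ?_ ?_ fun x ↦ ?_
  · have hc : Continuous fun x : ℝ ↦ (x : ℂ) := Complex.continuous_ofReal
    exact ((hE.continuous.comp hc).mul continuous_const).sub
      (((differentiable_sharp hE).continuous.comp hc).mul continuous_const)
  · exact continuous_const.mul (continuous_const.sub Complex.continuous_ofReal)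
  · have hπ : (2 * π * I : ℂ) ≠ 0 := by simp [Real.pi_ne_zero]
    refine mul_ne_zero hπ (sub_ne_zero.2 fun h ↦ hw ?_)
    have := congrArg Complex.im h
    simpa using this

/-- **`K(w, ·)/E ∈ L²(ℝ)`** for non-real `w`: `‖K(w, x)/E(x)‖ ≤ M/‖x − w̄‖` on `ℝ`. [folklore] -/
theorem integrable_sq_norm_deBrangesKernel_div (hE : IsHermiteBiehler E) (hreal : ∀ x : ℝ, E x ≠ 0)
    {w : ℂ} (hw : w.im ≠ 0) :
    Integrable fun x : ℝ ↦ ‖deBrangesKernel E w x / E x‖ ^ 2 := by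
  set M : ℝ := (‖E w‖ + ‖sharp E w‖) / (2 * π) with hM
  have hM0 : 0 ≤ M := by positivity
  have hcw : (conj w).im ≠ 0 := by simpa using hw
  refine Integrable.mono' ((integrable_norm_inv_ofReal_sub_sq hcw).const_mul (M ^ 2)) ?_
    (ae_of_all _ fun x ↦ ?_)
  · refine (Continuous.norm ?_).aestronglyMeasurable.pow 2
    exact (continuous_deBrangesKernel_ofReal hE.differentiable hw).div
      (hE.differentiable.continuous.comp Complex.continuous_ofReal) hreal
  · rw [Real.norm_of_nonneg (by positivity), ← mul_pow]
    refine pow_le_pow_left₀ (norm_nonneg _) ?_ 2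
    rw [norm_inv, ← div_eq_mul_inv]
    exact norm_deBrangesKernel_div_le hE hreal w (by simp)

/-- **Decay of `K(w, ·)/E`**: `‖K(w, z)/E(z)‖ ≤ C/√(Im z)` for `Im z > 0` and `‖z‖` large
(any `w`). [folklore] -/
theorem exists_bound_deBrangesKernel_div (hE : IsHermiteBiehler E) (hreal : ∀ x : ℝ, E x ≠ 0)
    (w : ℂ) :
    ∃ C R₀ : ℝ, ∀ z : ℂ, 0 < z.im → R₀ ≤ ‖z‖ →
      ‖deBrangesKernel E w z / E z‖ ≤ C / √z.im := by
  set M : ℝ := (‖E w‖ + ‖sharp E w‖) / (2 * π) with hM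
  have hM0 : 0 ≤ M := by positivity
  refine ⟨2 * M, max 1 (2 * ‖w‖), fun z hz hR ↦ ?_⟩
  have h1 : 1 ≤ ‖z‖ := (le_max_left _ _).trans hR
  have h2 : 2 * ‖w‖ ≤ ‖z‖ := (le_max_right _ _).trans hR
  have hzpos : 0 < ‖z‖ := by linarith
  have hzcw : ‖z‖ / 2 ≤ ‖z - conj w‖ := by
    have := norm_sub_norm_le z (conj w)
    rw [Complex.norm_conj] at this
    linarith
  have hsq : √z.im ≤ ‖z‖ := sqrt_im_le_norm h1
  have hypos : 0 < √z.im := Real.sqrt_pos.2 hz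
  calc ‖deBrangesKernel E w z / E z‖ ≤ M / ‖z - conj w‖ :=
        norm_deBrangesKernel_div_le hE hreal w hz.le
    _ ≤ M / (‖z‖ / 2) := div_le_div_of_nonneg_left hM0 (by positivity) hzcw
    _ = 2 * M / ‖z‖ := by field_simp
    _ ≤ 2 * M / √z.im := div_le_div_of_nonneg_left (by positivity) hypos hsq

/-- The joint decay hypothesis (for `F/E` and `F♯/E`) used below, assembled from separate
bounds. [folklore] -/
theorem exists_joint_bound {F : ℂ → ℂ}
    (h₁ : ∃ C R₀ : ℝ, ∀ z : ℂ, 0 < z.im → R₀ ≤ ‖z‖ → ‖F z / E z‖ ≤ C / √z.im)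
    (h₂ : ∃ C R₀ : ℝ, ∀ z : ℂ, 0 < z.im → R₀ ≤ ‖z‖ → ‖sharp F z / E z‖ ≤ C / √z.im) :
    ∃ C R₀ : ℝ, ∀ z : ℂ, 0 < z.im → R₀ ≤ ‖z‖ →
      ‖F z / E z‖ ≤ C / √z.im ∧ ‖sharp F z / E z‖ ≤ C / √z.im := by
  obtain ⟨C₁, R₁, h₁⟩ := h₁
  obtain ⟨C₂, R₂, h₂⟩ := h₂
  refine ⟨max C₁ C₂, max R₁ R₂, fun z hz hR ↦ ⟨?_, ?_⟩⟩
  · refine (h₁ z hz ((le_max_left _ _).trans hR)).trans ?_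
    gcongr
    exact le_max_left _ _
  · refine (h₂ z hz ((le_max_right _ _).trans hR)).trans ?_
    gcongr
    exact le_max_right _ _

/-- The kernel functions satisfy the joint decay hypothesis: for an entire `K` agreeing with
`K(w, ·)` off `w̄` (`w` non-real), `K/E` and `K♯/E = K(w̄, ·)/E` are `O(1/√(Im z))` far out.
[folklore] -/
theorem exists_joint_bound_kernel (hE : IsHermiteBiehler E) (hreal : ∀ x : ℝ, E x ≠ 0)
    {w : ℂ} (hw : w.im ≠ 0) {K : ℂ → ℂ} (hK : ∀ z : ℂ, z ≠ conj w → K z = deBrangesKernel E w z) :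
    ∃ C R₀ : ℝ, ∀ z : ℂ, 0 < z.im → R₀ ≤ ‖z‖ →
      ‖K z / E z‖ ≤ C / √z.im ∧ ‖sharp K z / E z‖ ≤ C / √z.im := by
  have hw0 : 0 < ‖w‖ := norm_pos_iff.2 (by rintro rfl; simp at hw)
  refine exists_joint_bound ?_ ?_
  · obtain ⟨C, R₀, h⟩ := exists_bound_deBrangesKernel_div hE hreal w
    refine ⟨C, max R₀ (2 * ‖w‖), fun z hz hR ↦ ?_⟩
    have hz' : z ≠ conj w := by
      rintro rfl
      rw [Complex.norm_conj] at hR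
      linarith [(le_max_right _ _).trans hR]
    rw [hK z hz']
    exact h z hz ((le_max_left _ _).trans hR)
  · obtain ⟨C, R₀, h⟩ := exists_bound_deBrangesKernel_div hE hreal (conj w)
    refine ⟨C, max R₀ (2 * ‖w‖), fun z hz hR ↦ ?_⟩
    have hz' : z ≠ w := by
      rintro rfl
      linarith [(le_max_right _ _).trans hR]
    have hsharp : sharp K z = deBrangesKernel E (conj w) z := by
      rw [← sharp_deBrangesKernel, sharp_apply, sharp_apply, hK (conj z)]
      intro h'
      exact hz' (by simpa using congrArg conj h')
    rw [hsharp]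
    exact h z hz ((le_max_left _ _).trans hR)

/-! ### The reproducing identity (2.2) -/

/-- Conjugation preserves integrability (on `ℝ`, complex-valued). [folklore] -/
theorem integrable_conj {u : ℝ → ℂ} (hu : Integrable u) : Integrable fun x ↦ conj (u x) := by
  have := Complex.conjCLE.toContinuousLinearMap.integrable_comp hu
  simpa using this

/-- The integrand of `⟨F, K(w, ·)⟩_{𝓗(E)}` on the real axis, split along `F/E` and `F♯/E`:
`F(x) conj K(w, x)/|E(x)|² = (2πi)⁻¹ (E(w) (F/E)(x)/(x − w) − E♯(w) conj((F♯/E)(x)/(x − w̄)))`.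
[folklore] -/
theorem inner_kernel_integrand (hreal : ∀ x : ℝ, E x ≠ 0) (F : ℂ → ℂ) {w : ℂ} (hw : w.im ≠ 0)
    (x : ℝ) :
    F x * conj (deBrangesKernel E w x) / ((‖E x‖ : ℂ) ^ 2) =
      (2 * π * I)⁻¹ * (E w * (F x / E x / (x - w)) -
        sharp E w * conj (sharp F x / E x / (x - conj w))) := by
  have hEx : E x ≠ 0 := hreal x
  have hEx' : conj (E x) ≠ 0 := (map_ne_zero _).2 hEx
  have hxw : (x : ℂ) - w ≠ 0 := by
    intro h
    have := congrArg Complex.im h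
    simp only [sub_im, ofReal_im, zero_sub, zero_im, neg_eq_zero] at this
    exact hw this
  have hπ : (2 * π * I : ℂ) ≠ 0 := by simp [Real.pi_ne_zero]
  rw [conj_deBrangesKernel, ← Complex.mul_conj' (E x)]
  simp only [deBrangesKernel, sharp_apply, Complex.conj_ofReal, Complex.conj_conj, map_div₀,
    map_sub]
  field_simp

/-- **The reproducing identity of `𝓗(E)` (Conrey–Li (2.2)).** Let `E` be Hermite–Biehler
without real zeros, `F` entire with `F/E ∈ L²(ℝ)` and with `F/E`, `F♯/E = O(1/√(Im z))` for
`Im z > 0`, `‖z‖` large. Then `⟨F, K(w, ·)⟩_{𝓗(E)} = F(w)` for every non-real `w`. (Proof as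
indicated by Conrey–Li: Cauchy's formula, resp. theorem, for the upper half-plane applied to
`F/E` and `F♯/E`.) [cite: ConreyLi2000, §2 (2.2)] -/
theorem deBrangesInner_deBrangesKernel (hE : IsHermiteBiehler E) (hreal : ∀ x : ℝ, E x ≠ 0)
    {F : ℂ → ℂ} (hF : Differentiable ℂ F) (hF2 : Integrable fun x : ℝ ↦ ‖F x / E x‖ ^ 2)
    (hFb : ∃ C R₀ : ℝ, ∀ z : ℂ, 0 < z.im → R₀ ≤ ‖z‖ →
      ‖F z / E z‖ ≤ C / √z.im ∧ ‖sharp F z / E z‖ ≤ C / √z.im)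
    {w : ℂ} (hw : w.im ≠ 0) :
    deBrangesInner E F (deBrangesKernel E w) = F w := by
  obtain ⟨C, R₀, hb⟩ := hFb
  have hC' : 0 ≤ max C 0 := le_max_right _ _
  have hb1 : ∀ z : ℂ, 0 < z.im → R₀ ≤ ‖z‖ → ‖F z / E z‖ ≤ max C 0 / √z.im :=
    fun z hz hR ↦ (hb z hz hR).1.trans (by gcongr; exact le_max_left _ _)
  have hb2 : ∀ z : ℂ, 0 < z.im → R₀ ≤ ‖z‖ → ‖sharp F z / E z‖ ≤ max C 0 / √z.im :=
    fun z hz hR ↦ (hb z hz hR).2.trans (by gcongr; exact le_max_left _ _)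
  have hd1 : ∀ z : ℂ, 0 ≤ z.im → DifferentiableAt ℂ (fun z ↦ F z / E z) z := fun z hz ↦
    (hF z).div (hE.differentiable z) (hE.ne_zero_of_im_nonneg hreal hz)
  have hd2 : ∀ z : ℂ, 0 ≤ z.im → DifferentiableAt ℂ (fun z ↦ sharp F z / E z) z := fun z hz ↦
    (differentiable_sharp hF z).div (hE.differentiable z) (hE.ne_zero_of_im_nonneg hreal hz)
  have hi2 : Integrable fun x : ℝ ↦ ‖sharp F x / E x‖ ^ 2 := by
    refine hF2.congr (ae_of_all _ fun x ↦ ?_)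
    simp only [norm_div, sharp_ofReal, Complex.norm_conj]
  -- integrability of the two pieces of the integrand
  have hA : Integrable fun x : ℝ ↦ E w * (F x / E x / (x - w)) :=
    (integrable_div_ofReal_sub (aestronglyMeasurable_ofReal_of_differentiableAt hd1) hF2 hw).const_mul
      _
  have hcw : (conj w).im ≠ 0 := by simpa using hw
  have hB0 : Integrable fun x : ℝ ↦ sharp F x / E x / (x - conj w) :=
    integrable_div_ofReal_sub (aestronglyMeasurable_ofReal_of_differentiableAt hd2) hi2 hcw
  have hB : Integrable fun x : ℝ ↦ sharp E w * conj (sharp F x / E x / (x - conj w)) :=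
    (integrable_conj hB0).const_mul _
  unfold deBrangesInner
  simp_rw [inner_kernel_integrand hreal F hw]
  rw [MeasureTheory.integral_const_mul, integral_sub hA hB, MeasureTheory.integral_const_mul,
    MeasureTheory.integral_const_mul, integral_conj]
  have hπ : (2 * π * I : ℂ) ≠ 0 := by simp [Real.pi_ne_zero]
  rcases lt_or_gt_of_ne hw with hneg | hpos
  · -- `Im w < 0`: Cauchy's theorem for `F/E`, Cauchy's formula for `F♯/E` at `w̄`
    rw [integral_div_sub_eq_zero_of_im_neg hC' hd1 hF2 hb1 hneg,
      integral_div_sub_eq_of_im_pos hC' hd2 hi2 hb2 (w := conj w) (by simpa using hneg)]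
    have hEw : sharp E w ≠ 0 := hE.sharp_ne_zero_of_im_nonpos hreal hneg.le
    simp only [sharp_apply, Complex.conj_conj, map_mul, map_div₀, Complex.conj_I, map_ofNat,
      Complex.conj_ofReal] at hEw ⊢
    field_simp
    ring
  · -- `Im w > 0`: Cauchy's formula for `F/E` at `w`, Cauchy's theorem for `F♯/E`
    rw [integral_div_sub_eq_of_im_pos hC' hd1 hF2 hb1 hpos,
      integral_div_sub_eq_zero_of_im_neg hC' hd2 hi2 hb2 (a := conj w) (by simpa using hpos)]
    have hEw : E w ≠ 0 := hE.ne_zero_of_im_pos hpos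
    simp only [map_zero, mul_zero, sub_zero]
    field_simp

/-! ### Norms of the kernel functions and the inequality (2.1) -/

/-- The integrand of `⟨F, G⟩_{𝓗(E)}` is `(F/E) · conj (G/E)` on the real axis. [folklore] -/
theorem inner_integrand_eq (hreal : ∀ x : ℝ, E x ≠ 0) (F G : ℂ → ℂ) (x : ℝ) :
    F x * conj (G x) / ((‖E x‖ : ℂ) ^ 2) = (F x / E x) * conj (G x / E x) := by
  have hEx : E x ≠ 0 := hreal x
  have hEx' : conj (E x) ≠ 0 := (map_ne_zero _).2 hEx
  rw [← Complex.mul_conj' (E x), map_div₀]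
  field_simp

/-- The integrand of `⟨F, G⟩_{𝓗(E)}` is integrable when `F/E, G/E ∈ L²(ℝ)`. [folklore] -/
theorem integrable_inner_integrand (hreal : ∀ x : ℝ, E x ≠ 0) {F G : ℂ → ℂ}
    (hFm : AEStronglyMeasurable (fun x : ℝ ↦ F x / E x) volume)
    (hGm : AEStronglyMeasurable (fun x : ℝ ↦ G x / E x) volume)
    (hF2 : Integrable fun x : ℝ ↦ ‖F x / E x‖ ^ 2) (hG2 : Integrable fun x : ℝ ↦ ‖G x / E x‖ ^ 2) :
    Integrable fun x : ℝ ↦ F x * conj (G x) / ((‖E x‖ : ℂ) ^ 2) := by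
  simp_rw [inner_integrand_eq hreal]
  refine Integrable.mono' ((hF2.add hG2).div_const 2) (hFm.mul hGm.star)
    (ae_of_all _ fun x ↦ ?_)
  simp only [Pi.add_apply]
  rw [norm_mul, Complex.norm_conj]
  nlinarith [sq_nonneg (‖F x / E x‖ - ‖G x / E x‖), norm_nonneg (F x / E x),
    norm_nonneg (G x / E x)]

/-- **Cauchy–Schwarz in `L²(ℝ, |E|⁻² dx)`**: `|⟨F, G⟩_{𝓗(E)}|² ≤ ‖F‖² ‖G‖²`. [folklore] -/
theorem norm_deBrangesInner_sq_le (hreal : ∀ x : ℝ, E x ≠ 0) {F G : ℂ → ℂ}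
    (hFm : AEStronglyMeasurable (fun x : ℝ ↦ F x / E x) volume)
    (hGm : AEStronglyMeasurable (fun x : ℝ ↦ G x / E x) volume)
    (hF2 : Integrable fun x : ℝ ↦ ‖F x / E x‖ ^ 2) (hG2 : Integrable fun x : ℝ ↦ ‖G x / E x‖ ^ 2) :
    ‖deBrangesInner E F G‖ ^ 2 ≤ deBrangesNormSq E F * deBrangesNormSq E G := by
  have hu : MemLp (fun x : ℝ ↦ F x / E x) 2 volume := (memLp_two_iff_integrable_sq_norm hFm).2 hF2
  have hv : MemLp (fun x : ℝ ↦ G x / E x) 2 volume := (memLp_two_iff_integrable_sq_norm hGm).2 hG2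
  have h1 : ‖deBrangesInner E F G‖ ≤ ∫ x : ℝ, ‖F x / E x‖ * ‖G x / E x‖ := by
    unfold deBrangesInner
    simp_rw [inner_integrand_eq hreal]
    refine (MeasureTheory.norm_integral_le_integral_norm _).trans (le_of_eq ?_)
    refine integral_congr_ae (ae_of_all _ fun x ↦ ?_)
    simp only [norm_mul, Complex.norm_conj]
  have h2 := integral_mul_norm_le_Lp_mul_Lq (μ := volume) Real.HolderConjugate.two_two
    (f := fun x : ℝ ↦ F x / E x) (g := fun x : ℝ ↦ G x / E x) (by simpa using hu)
    (by simpa using hv)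
  simp only [Real.rpow_two, one_div] at h2
  have h3 : ‖deBrangesInner E F G‖ ≤
      (deBrangesNormSq E F) ^ (2⁻¹ : ℝ) * (deBrangesNormSq E G) ^ (2⁻¹ : ℝ) := h1.trans h2
  have hA : 0 ≤ deBrangesNormSq E F := deBrangesNormSq_nonneg E F
  have hB : 0 ≤ deBrangesNormSq E G := deBrangesNormSq_nonneg E G
  calc ‖deBrangesInner E F G‖ ^ 2
      ≤ ((deBrangesNormSq E F) ^ (2⁻¹ : ℝ) * (deBrangesNormSq E G) ^ (2⁻¹ : ℝ)) ^ 2 :=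
        pow_le_pow_left₀ (norm_nonneg _) h3 2
    _ = deBrangesNormSq E F * deBrangesNormSq E G := by
        rw [mul_pow, ← Real.rpow_natCast, ← Real.rpow_natCast, ← Real.rpow_mul hA,
          ← Real.rpow_mul hB]
        norm_num

/-- `⟨F, G⟩_{𝓗(E)}` only depends on the values of `G` on the real axis. [folklore] -/
theorem deBrangesInner_congr_right {F G G' : ℂ → ℂ} (h : ∀ x : ℝ, G x = G' x) :
    deBrangesInner E F G = deBrangesInner E F G' := by
  unfold deBrangesInner
  simp_rw [h]

/-- `⟨F, G⟩_{𝓗(E)}` only depends on the values of `F` on the real axis. [folklore] -/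
theorem deBrangesInner_congr_left {F F' G : ℂ → ℂ} (h : ∀ x : ℝ, F x = F' x) :
    deBrangesInner E F G = deBrangesInner E F' G := by
  unfold deBrangesInner
  simp_rw [h]

/-- `‖F‖_{𝓗(E)}` only depends on the values of `F` on the real axis. [folklore] -/
theorem deBrangesNormSq_congr {F F' : ℂ → ℂ} (h : ∀ x : ℝ, F x = F' x) :
    deBrangesNormSq E F = deBrangesNormSq E F' := by
  unfold deBrangesNormSq
  simp_rw [h]

/-- **`‖K(w, ·)‖²_{𝓗(E)} = K(w, w)`** for non-real `w` (the reproducing identity applied to the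
kernel function itself). [cite: ConreyLi2000, §2 (2.2)] -/
theorem deBrangesNormSq_deBrangesKernel (hE : IsHermiteBiehler E) (hreal : ∀ x : ℝ, E x ≠ 0)
    {w : ℂ} (hw : w.im ≠ 0) :
    deBrangesNormSq E (deBrangesKernel E w) = deBrangesKernelDiag E w := by
  obtain ⟨K, hKd, hKeq, -⟩ := exists_differentiable_eq_deBrangesKernel hE.differentiable w
  have hKx : ∀ x : ℝ, K x = deBrangesKernel E w x := fun x ↦ hKeq x (by
    intro h
    have := congrArg Complex.im h
    simp only [ofReal_im, Complex.conj_im] at this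
    exact hw (by linarith))
  have hK2 : Integrable fun x : ℝ ↦ ‖K x / E x‖ ^ 2 := by
    simp_rw [hKx]
    exact integrable_sq_norm_deBrangesKernel_div hE hreal hw
  have hrep := deBrangesInner_deBrangesKernel hE hreal hKd hK2
    (exists_joint_bound_kernel hE hreal hw hKeq) hw
  have hww : w ≠ conj w := fun h ↦ hw (Complex.conj_eq_iff_im.1 h.symm)
  rw [hKeq w hww, deBrangesKernel_self, ← deBrangesInner_congr_right hKx,
    deBrangesInner_self, deBrangesNormSq_congr hKx] at hrep
  exact_mod_cast hrep

/-- **Conrey–Li's inequality (2.1) from the reproducing identity**: for `E` Hermite–Biehler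
without real zeros and `F` entire with `F/E ∈ L²(ℝ)` and `F/E, F♯/E = O(1/√(Im z))` far out,
`|F(z)|² ≤ ‖F‖²_{𝓗(E)} K(z, z)` at every non-real `z` (`F(z) = ⟨F, K(z, ·)⟩`, Cauchy–Schwarz,
`‖K(z, ·)‖² = K(z, z)`). [cite: ConreyLi2000, §2 (2.1)–(2.2)] -/
theorem hasKernelBound_of_bound (hE : IsHermiteBiehler E) (hreal : ∀ x : ℝ, E x ≠ 0)
    {F : ℂ → ℂ} (hF : Differentiable ℂ F) (hF2 : Integrable fun x : ℝ ↦ ‖F x / E x‖ ^ 2)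
    (hFb : ∃ C R₀ : ℝ, ∀ z : ℂ, 0 < z.im → R₀ ≤ ‖z‖ →
      ‖F z / E z‖ ≤ C / √z.im ∧ ‖sharp F z / E z‖ ≤ C / √z.im) :
    HasKernelBound E F := by
  intro z hz
  have hrep := deBrangesInner_deBrangesKernel hE hreal hF hF2 hFb hz
  have hFm : AEStronglyMeasurable (fun x : ℝ ↦ F x / E x) volume :=
    aestronglyMeasurable_ofReal_of_differentiableAt fun u hu ↦
      (hF u).div (hE.differentiable u) (hE.ne_zero_of_im_nonneg hreal hu)
  have hKm : AEStronglyMeasurable (fun x : ℝ ↦ deBrangesKernel E z x / E x) volume :=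
    ((continuous_deBrangesKernel_ofReal hE.differentiable hz).div
      (hE.differentiable.continuous.comp Complex.continuous_ofReal) hreal).aestronglyMeasurable
  have hCS := norm_deBrangesInner_sq_le hreal hFm hKm hF2
    (integrable_sq_norm_deBrangesKernel_div hE hreal hz)
  rwa [hrep, deBrangesNormSq_deBrangesKernel hE hreal hz] at hCS

end Literature.Analysis.DeBrangesSpaces
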